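import Summits.Ventures.PackingBounds.ThreePointCert.K5Cert

/-!
# κ(5) ≤ 45 (three-point bound, kernel-checked): kernel validation of the blocks of (i') and of the `FI` expansion

Framing: lottery ticket; floor = certified bounds/negative ranges. Venture `PackingBounds` (cell
`pub-packcert`), three-point SDP family. Integer data of a feasible point of the Bachoc–Vallentin
semidefinite program (n = 5, s = 1/2, degree d = 8, symmetric
sums of squares), derived by `pub-packcert-sdp/code/cert2lean.py` from the exact rational
certificate `sdp-n5-d8-s1-2-sym.json` of the cell (two independent exact verifiers + referee), in the
units of the kernel checker `ThreePointCert.Check` (soundness `ThreePointCert.Sound`). Generated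
file: plain lists of integers / monomials.
-/

namespace Summit.Ventures.PackingBounds.ThreePointCert.K5

open Literature.Geometry.DiscreteGeometry Literature.Geometry.DiscreteGeometry.PolyCert PolyCert.SPoly

set_option maxHeartbeats 0 in
/-- Block `Q0`: rows from 0 ((gQ0.z.length - 0) rows) of `zᵀ(LLᵀ)z` added to `[]` give `eQ0` (kernel). -/
theorem okQ0_1 : chunkOK K5.gQ0 0 (K5.gQ0.z.length - 0) [] K5.eQ0 = true := by
  decide +kernel

set_option maxHeartbeats 0 in
/-- Block `Q1`: rows from 0 ((gQ1.z.length - 0) rows) of `zᵀ(LLᵀ)z` added to `[]` give `eQ1` (kernel). -/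
theorem okQ1_1 : chunkOK K5.gQ1 0 (K5.gQ1.z.length - 0) [] K5.eQ1 = true := by
  decide +kernel

set_option maxHeartbeats 0 in
/-- `FI` expansion, blocks [0, 1] (kernel). -/
theorem okF_1 : FchunkOKG K5.cert.n K5.cert.d [FBlk.mk 0 K5.fw0, FBlk.mk 1 K5.fw1] [] K5.dFc1 = true := by
  decide +kernel

set_option maxHeartbeats 0 in
/-- `FI` expansion, blocks [2] (kernel). -/
theorem okF_2 : FchunkOKG K5.cert.n K5.cert.d [FBlk.mk 2 K5.fw2] K5.dFc1 K5.dFc2 = true := by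
  decide +kernel

set_option maxHeartbeats 0 in
/-- `FI` expansion, blocks [3] (kernel). -/
theorem okF_3 : FchunkOKG K5.cert.n K5.cert.d [FBlk.mk 3 K5.fw3] K5.dFc2 K5.dFc3 = true := by
  decide +kernel

set_option maxHeartbeats 0 in
/-- `FI` expansion, blocks [4] (kernel). -/
theorem okF_4 : FchunkOKG K5.cert.n K5.cert.d [FBlk.mk 4 K5.fw4] K5.dFc3 K5.dFc4 = true := by
  decide +kernel

set_option maxHeartbeats 0 in
/-- `FI` expansion, blocks [5] (kernel). -/
theorem okF_5 : FchunkOKG K5.cert.n K5.cert.d [FBlk.mk 5 K5.fw5] K5.dFc4 K5.dFc5 = true := by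
  decide +kernel

set_option maxHeartbeats 0 in
/-- `FI` expansion, blocks [6, 7, 8] (kernel). -/
theorem okF_6 : FchunkOKG K5.cert.n K5.cert.d [FBlk.mk 6 K5.fw6, FBlk.mk 7 K5.fw7, FBlk.mk 8 K5.fw8] K5.dFc5 K5.eFP = true := by
  decide +kernel

end Summit.Ventures.PackingBounds.ThreePointCert.K5
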